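import Summits.Ventures.CertifiedManyBodySolver.Downfold.BoxesLa214V115M2bBoxReadExt
import Summits.Ventures.CertifiedManyBodySolver.Rows.DopedTLCorrPinnedPairU
import HarnessLib

/-!
# The PINNED t′-PAIR shape: two per-vertex certificate rows sharing their equation-of-motion functional, and the
# t′-BUNDLE row (`TPrimeBundleOrbitLowerRow` / `…Ext`) it yields BY THEOREM — the boxdual reader's covariance-box law in
# the t′ direction at the level of states (cell `pub/hubbard-obs` × `pub/hubbard-downfold`, D-0154 (1)(C) COVERAGE La214;
# seat `hubbard-cov-la214-unc-2`, lineage desk)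

HONEST FRAMING: NOTHING IS ASSERTED HERE: one `def … : Prop` (a claim-node SHAPE) and solver-free theorems; no `sorry`, no named fact, zero
compute. The t′-direction sibling of hubbard-cov-hg1201-box-1 g2's `Rows/DopedTLCorrPinnedPairU.lean` (pinned U-pairs, docc box), for the pinned
t′-PAIRS of the La214 station plans (`Downfold/BoxesLa214V115M2bBoxRead.lean` / `…BoxReadExt.lean`: hub j298764 with the spokes S1′ j303210, S2′ j303208,
M′ j306265, Q′ j306842 at the Mott station `(U, n) = (29/5, 1)`).

WHY. A t′-BUNDLE claim node (`TPrimeBundleOrbitLowerRow U n s₁ s₂ f₁ f₂ u F X`, editions W / K / K-AF; `…Ext P …` with the T′-BOX letter premise) records the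
OUTPUT `F0` of the boxdual law applied to a PINNED t′-pair {A, B}: two `certsdp-cert/0` certificates at `s = sA < sB` (same `U`, same density `n`) whose
equation-of-motion multipliers COINCIDE (the spoke is solved with the hub's eom multipliers pinned; `pinfold` verdict), and which differ only in their two
`le`-row multipliers `κ = (κ_cap, κ_cut)` and their PSD blocks. Until now the passage {two certificates} ↦ {bundle row} lived in python lineages
(the reader; `kaf_*.py`, `rekey_*.py`, `derive_*.py`) + the kernel check of its last mile (`…_derivation` theorems). THIS FILE types the passage itself:

* §A the SHAPE `SquareTTPrimePinnedPairRowT U n sA sB cA cB flA flB βA κA κA' βB κB κB' X` — what the two certificates + the pinning establish AT THE LEVEL OF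
  STATES: there are two real functionals `E₀, E₁` of the infinite-volume state (the shared eom penalty split as `Σ_k m_k ω([H₀, O_k]) + s·Σ_k m_k ω([T′, O_k])`,
  `T′` the unit diagonal hopping) such that for every `s ∈ [sA, sB]` and every torus limit `ω` of unit sector ground states at `(s, U, n)`:
  (E) `E₀ ω + s·E₁ ω = 0` (stationarity of a ground state under ITS OWN Hamiltonian);
  (V_A) `βA + κA·(cA − e + (s − sA)·K₂ ω) + κA'·(e − (s − sA)·K₂ ω − flA) + E₀ ω + sA·E₁ ω ≤ X̄_{sA} ω` — weak duality of certificate A evaluated on the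
  (symmetrised) moments of `ω`: its cap / cut rows see the energy functional WITH HOPPING `sA`, i.e. `e − (s − sA)·K₂ ω` (`e = e₀(1, s, U, n)` the ground-state
  energy density, `K₂ ω = e_{Φ(0,1,0)}(ω)` the unit diagonal-hopping energy per site `= −4(v25 + v116)` in the readers' letters), its eom rows see
  `H_{sA} = H₀ + sA·T′`, its PSD penalties are `≥ 0` and dropped; (V_B) the same for B. (`X̄_c ω = |D₄|⁻¹ Σ_γ Re ω_{γΛ₇}(Γ (X c))`, the `D₄`-orbit mean the
  reduced program bounds; `X c` the objective word of the vertex at `c`.)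
* §B edges: re-pricing the caps (`β ↦ β − κ_cap·(c″ − c)`, an identity row by row) and β-monotonicity;
* §C **PINNED PAIR ⇒ t′-BUNDLE ROW.** For `sA < sB`, `κ ≥ 0`, a row cap `u ≤ cA, cB` (re-price first), the objective CHORD condition
  `(sB − s)·X̄_{sA} + (s − sA)·X̄_{sB} ≤ (sB − sA)·X̄_s` on translation-invariant states (an identity for a constant objective and for the own word `−X₀(s)`),
  a K₂-box `|K₂ ω| ≤ tb` under the row's extra premise `P s ω`, and ANY `F` below the segment parabola (`w = (s − sA)/(sB − sA)`)
  `(1 − w)βA + wβB − w(1 − w)·L`, `L = (sB − sA)·|Δκ_cap − Δκ_cut|·tb − Δκ_cut·(−(flB − flA))` (`Δ = B − A`) on `w ∈ [0, 1]`: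
  `TPrimeBundleOrbitLowerRowExt P U n sA sB flA flB u F X` (`bundleExt`); and with the KERNEL box `tb = 16211390/10⁷` (`|K₂| ≤ 16/π²` on torus limits of
  unit fixed-density vectors, `IsTorusLimitOf.abs_meanEnergy_diagHop_le_decimal` — Lieb–Loss) the PLAIN row `TPrimeBundleOrbitLowerRow U n sA sB flA flB u F X`
  (`bundle`) — every reader box (`8h♯ = 1.6216`, `8h = 2.528`, unit `8`) is looser, so reader-priced nodes follow a fortiori (`tPrimePair_slot_mono`). Proof = the reader's law, line by line: convex combination `(1 − w)·(V_A) + w·(V_B)`, (E) kills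
  the eom part at the barycentre, each cap slack is `≥ 0` (`e ≤ u ≤ c`), the combined cut multiplier times the chord-floor slack is `≥ 0` up to the constant
  covariance `w(1 − w)·d`, the hopping coefficient `−w(1 − w)·Δs·(Δκ_cap − Δκ_cut)·K₂ ω` is priced on the box `|K₂ ω| ≤ tb`, and the objective chord closes;
* §D the floor kinds (completed square / endpoint lemmas reused from `Rows/DopedTLCorrPinnedPairU.lean`): INTERIOR (`0 < L`: `F ≤ βA − (L − g)²/(4L)`) and VERTEX (`L ≤ |g|`: `F ≤ min βA βB`, how the K1 pairs {hub′, S1′} / {hub′, Q′} price);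
* §E the objective chord condition discharged for the two objective families of record: constant (corner objective) and `s ↦ −X₀(s, Uo)` (own word).

So a pinned-pair claim node (per-vertex literals + the pinning) yields the cell's t′-bundle node as a THEOREM (`F0`, `L`, `d`, floor kind kernel-checked).
WHAT THIS IS NOT: a soundness theorem for the reduced moment program (the shape is a CLAIM about states, justified outside Lean by the two certificates, the
`D₄`/translation averaging of moment vectors and the pinfold verdict); a statement that any pair has printed; a number. CONTROL / CALIBRATION wording class (xx1);
no node of record, tier, word or registry row changes; no summit statement is proved here.

References: D. P. Bertsekas, *Nonlinear Programming*, 2nd ed. (1999), Prop. 5.1.3 [Bertsekas1999NonlinearProgramming]; S. Boyd, L. Vandenberghe,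
*Convex Optimization* (2004) §5.9 [BoydVandenberghe2004]; E. H. Lieb, M. Loss, *Analysis* (AMS 2001, 2nd ed.) §8, Theorem 8.2 [LiebLoss1993].
-/

noncomputable section

namespace Summit.Ventures.CertifiedManyBodySolver.Downfold

open Literature.MathematicalPhysics.QuantumLattice
open Matrix HubbardWave0 Literature.Probability.LatticeModels ThermodynamicLimit Filter Topology
open Summit.Ventures.CertifiedManyBodySolver.Observables
open scoped BigOperators ComplexOrder

/-- The `D₄`-orbit mean of the objective word `X c` in the state `ω` (the quantity every `…OrbitLowerRow` bounds from below). [folklore] -/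
def tPrimeObjOrbitMean (X : ℝ → FermionOp (Literature.Probability.LatticeModels.box 2 7)) (c : ℝ) (ω : InfVolFermionState 2) : ℝ :=
  ((Finset.univ : Finset (DihedralGroup 4)).card : ℝ)⁻¹ * ∑ g ∈ (Finset.univ : Finset (DihedralGroup 4)),
    (ω.expect (d4ShiftSet g 0 (Literature.Probability.LatticeModels.box 2 7))
      (fermionEmbed (PolySite.d4Emb g 0 (Literature.Probability.LatticeModels.box 2 7)) (X c))).re

/-! ## §A  The pinned t′-pair row SHAPE (state level) -/

section Defs

/-- §A **PINNED t′-PAIR ROW SHAPE** `SquareTTPrimePinnedPairRowT U n sA sB cA cB flA flB βA κA κA' βB κB κB' X`. Square lattice `ℤ²`, `t = 1`, fixed `U` and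
density `n`; two certificate vertices `t′ = sA` (data `βA` = certified bound, `κA`, `κA'` = cap-row and cut-row multipliers, cap rhs `cA`, cut floor `flA`,
objective word `X sA`) and `t′ = sB` (the same with `B`), solved with SHARED equation-of-motion multipliers: there exist real functionals `E₀ E₁` of the state such
that for every `s ∈ [sA, sB]` and every torus limit `ω` of unit ground states of the sectors `(rectN n L_j, S^z = 0)` of `hubbardTorusTT' L_j 1 s U`:
(E) `E₀ ω + s·E₁ ω = 0`; (V_A) `βA + κA(cA − e + (s − sA)K₂) + κA'(e − (s − sA)K₂ − flA) + E₀ ω + sA·E₁ ω ≤ X̄_{sA} ω`; (V_B) likewise — with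
`e = energyDensityTT' 1 s U n`, `K₂ = ω.meanEnergy (hubbardTTPrimeFermionInteraction 0 1 0) 1`, `X̄_c = tPrimeObjOrbitMean X c`.
[cite: Bertsekas1999NonlinearProgramming, Prop. 5.1.3] [cite: BoydVandenberghe2004, §5.9] -/
def SquareTTPrimePinnedPairRowT (U n sA sB : ℝ) (cA cB flA flB : ℚ) (βA κA κA' βB κB κB' : ℚ)
    (X : ℝ → FermionOp (Literature.Probability.LatticeModels.box 2 7)) : Prop :=
  ∃ E₀ E₁ : InfVolFermionState 2 → ℝ,
    ∀ s ∈ Set.Icc sA sB,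
      ∀ (ω : InfVolFermionState 2) (Ls : ℕ → ℕ) (ψ : ∀ L, Fock (Orb (FermionTorus 2 L))),
        Tendsto Ls atTop atTop →
        (∀ j, IsGroundStateInSector (hubbardTorusTT' (Ls j) 1 s U) (rectN n (Ls j)) 0 (ψ (Ls j))) →
        (∀ j, star (ψ (Ls j)) ⬝ᵥ ψ (Ls j) = 1) → ω.IsTorusLimitOf ψ Ls →
        (E₀ ω + s * E₁ ω = 0) ∧
        (((βA : ℚ) : ℝ) + ((κA : ℚ) : ℝ) * (((cA : ℚ) : ℝ) - energyDensityTT' 1 s U n + (s - sA) * ω.meanEnergy (hubbardTTPrimeFermionInteraction 0 1 0) 1) +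
            ((κA' : ℚ) : ℝ) * (energyDensityTT' 1 s U n - (s - sA) * ω.meanEnergy (hubbardTTPrimeFermionInteraction 0 1 0) 1 - ((flA : ℚ) : ℝ)) +
            E₀ ω + sA * E₁ ω ≤ tPrimeObjOrbitMean X sA ω) ∧
        (((βB : ℚ) : ℝ) + ((κB : ℚ) : ℝ) * (((cB : ℚ) : ℝ) - energyDensityTT' 1 s U n + (s - sB) * ω.meanEnergy (hubbardTTPrimeFermionInteraction 0 1 0) 1) +
            ((κB' : ℚ) : ℝ) * (energyDensityTT' 1 s U n - (s - sB) * ω.meanEnergy (hubbardTTPrimeFermionInteraction 0 1 0) 1 - ((flB : ℚ) : ℝ)) +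
            E₀ ω + sB * E₁ ω ≤ tPrimeObjOrbitMean X sB ω)

end Defs

/-! ## §B  Solver-free edges -/

section Edges

variable {U n sA sB : ℝ} {cA cB flA flB βA κA κA' βB κB κB' : ℚ} {X : ℝ → FermionOp (Literature.Probability.LatticeModels.box 2 7)}

/-- **Re-pricing the caps**: with the SAME multipliers, moving the cap rhs from `c` to `c″` at either vertex and the bound from `β` to `β − κ_cap·(c″ − c)` leaves
every vertex row UNCHANGED (an identity); this is how a pair solved at the W cap `HI29` is booked at the kernel caps (editions K / K-AF: `β′ = b − κ_cap·(u − HI29)`).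
[cite: BoydVandenberghe2004, §5.9] -/
theorem SquareTTPrimePinnedPairRowT.reprice
    (h : SquareTTPrimePinnedPairRowT U n sA sB cA cB flA flB βA κA κA' βB κB κB' X) (cA'' cB'' : ℚ) :
    SquareTTPrimePinnedPairRowT U n sA sB cA'' cB'' flA flB (βA - κA * (cA'' - cA)) κA κA' (βB - κB * (cB'' - cB)) κB κB' X := by
  obtain ⟨E₀, E₁, hh⟩ := h
  refine ⟨E₀, E₁, fun s hs ω Ls ψ hLs hψ hψ1 hω => ?_⟩
  obtain ⟨hE, hVA, hVB⟩ := hh s hs ω Ls ψ hLs hψ hψ1 hω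
  set e : ℝ := energyDensityTT' 1 s U n with he
  set T : ℝ := ω.meanEnergy (hubbardTTPrimeFermionInteraction 0 1 0) 1 with hT
  refine ⟨hE, ?_, ?_⟩
  · have key : (((βA - κA * (cA'' - cA) : ℚ)) : ℝ) + ((κA : ℚ) : ℝ) * (((cA'' : ℚ) : ℝ) - e + (s - sA) * T) =
        ((βA : ℚ) : ℝ) + ((κA : ℚ) : ℝ) * (((cA : ℚ) : ℝ) - e + (s - sA) * T) := by
      push_cast; ring
    linarith [hVA, key]
  · have key : (((βB - κB * (cB'' - cB) : ℚ)) : ℝ) + ((κB : ℚ) : ℝ) * (((cB'' : ℚ) : ℝ) - e + (s - sB) * T) =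
        ((βB : ℚ) : ℝ) + ((κB : ℚ) : ℝ) * (((cB : ℚ) : ℝ) - e + (s - sB) * T) := by
      push_cast; ring
    linarith [hVB, key]

/-- **Re-pricing the floors**: moving the cut floor from `fl` to `fl″` at either vertex and the bound from `β` to `β − κ_cut·(fl − fl″)` leaves every vertex row
unchanged (the identity behind `β′ = b − κ_cut·(lo_W − lo_K)`). [cite: BoydVandenberghe2004, §5.9] -/
theorem SquareTTPrimePinnedPairRowT.reprice_floor
    (h : SquareTTPrimePinnedPairRowT U n sA sB cA cB flA flB βA κA κA' βB κB κB' X) (flA'' flB'' : ℚ) :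
    SquareTTPrimePinnedPairRowT U n sA sB cA cB flA'' flB'' (βA - κA' * (flA - flA'')) κA κA' (βB - κB' * (flB - flB'')) κB κB' X := by
  obtain ⟨E₀, E₁, hh⟩ := h
  refine ⟨E₀, E₁, fun s hs ω Ls ψ hLs hψ hψ1 hω => ?_⟩
  obtain ⟨hE, hVA, hVB⟩ := hh s hs ω Ls ψ hLs hψ hψ1 hω
  set e : ℝ := energyDensityTT' 1 s U n with he
  set T : ℝ := ω.meanEnergy (hubbardTTPrimeFermionInteraction 0 1 0) 1 with hT
  refine ⟨hE, ?_, ?_⟩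
  · have key : (((βA - κA' * (flA - flA'') : ℚ)) : ℝ) + ((κA' : ℚ) : ℝ) * (e - (s - sA) * T - ((flA'' : ℚ) : ℝ)) =
        ((βA : ℚ) : ℝ) + ((κA' : ℚ) : ℝ) * (e - (s - sA) * T - ((flA : ℚ) : ℝ)) := by
      push_cast; ring
    linarith [hVA, key]
  · have key : (((βB - κB' * (flB - flB'') : ℚ)) : ℝ) + ((κB' : ℚ) : ℝ) * (e - (s - sB) * T - ((flB'' : ℚ) : ℝ)) =
        ((βB : ℚ) : ℝ) + ((κB' : ℚ) : ℝ) * (e - (s - sB) * T - ((flB : ℚ) : ℝ)) := by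
      push_cast; ring
    linarith [hVB, key]

/-- β-monotonicity: the shape survives any SMALLER vertex bounds. [folklore] -/
theorem SquareTTPrimePinnedPairRowT.mono
    (h : SquareTTPrimePinnedPairRowT U n sA sB cA cB flA flB βA κA κA' βB κB κB' X)
    {βA'' βB'' : ℚ} (hA : βA'' ≤ βA) (hB : βB'' ≤ βB) :
    SquareTTPrimePinnedPairRowT U n sA sB cA cB flA flB βA'' κA κA' βB'' κB κB' X := by
  obtain ⟨E₀, E₁, hh⟩ := h
  refine ⟨E₀, E₁, fun s hs ω Ls ψ hLs hψ hψ1 hω => ?_⟩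
  obtain ⟨hE, hVA, hVB⟩ := hh s hs ω Ls ψ hLs hψ hψ1 hω
  have hA' : ((βA'' : ℚ) : ℝ) ≤ ((βA : ℚ) : ℝ) := by exact_mod_cast hA
  have hB' : ((βB'' : ℚ) : ℝ) ≤ ((βB : ℚ) : ℝ) := by exact_mod_cast hB
  exact ⟨hE, by linarith, by linarith⟩

end Edges

/-! ## §C  PINNED PAIR ⇒ the t′-bundle row (the boxdual covariance-box law in the t′ direction, at the level of states) -/

section Law

variable {U n sA sB : ℝ} {cA cB flA flB βA κA κA' βB κB κB' : ℚ} {X : ℝ → FermionOp (Literature.Probability.LatticeModels.box 2 7)}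

/-- The declared chord floor at the barycentre `s = sA + w·(sB − sA)` is the convex combination of the vertex floors. [folklore] -/
theorem bundleChordFloor_baryc {sA sB : ℝ} (hAB : sA < sB) (flA flB : ℚ) (w : ℝ) :
    bundleChordFloor sA sB flA flB (sA + w * (sB - sA)) = (1 - w) * ((flA : ℚ) : ℝ) + w * ((flB : ℚ) : ℝ) := by
  unfold bundleChordFloor
  have hd : sB - sA ≠ 0 := (sub_pos.2 hAB).ne'
  field_simp
  ring

/-- **PINNED t′-PAIR ⇒ t′-BUNDLE ROW WITH AN EXTRA PREMISE** (the boxdual reader's covariance-box law as a theorem about states). Data: `sA < sB`; multipliers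
`κ ≥ 0`; a row cap `u` with `u ≤ cA`, `u ≤ cB`; a K₂-box `tb` valid on the row's binders under the premise `P` (torus-limit sector ground states with `P s ω` have `|K₂ ω| ≤ tb`); the objective CHORD condition on
translation-invariant states, division-free (`(sB − s)·X̄_{sA} + (s − sA)·X̄_{sB} ≤ (sB − sA)·X̄_s`); and a slot `F` below the segment parabola
`(1 − w)βA + wβB − w(1 − w)·L` for all `w ∈ [0, 1]`, `L = (sB − sA)·|Δκ_cap − Δκ_cut|·tb − Δκ_cut·(−(flB − flA))`, `Δ = B − A`. Then
`TPrimeBundleOrbitLowerRowExt P U n sA sB flA flB u F X`. [cite: Bertsekas1999NonlinearProgramming, Prop. 5.1.3] [cite: BoydVandenberghe2004, §5.9] -/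
theorem SquareTTPrimePinnedPairRowT.bundleExt
    (h : SquareTTPrimePinnedPairRowT U n sA sB cA cB flA flB βA κA κA' βB κB κB' X)
    (hAB : sA < sB) (hκA : 0 ≤ κA) (hκA' : 0 ≤ κA') (hκB : 0 ≤ κB) (hκB' : 0 ≤ κB')
    {u : ℚ} (huA : u ≤ cA) (huB : u ≤ cB)
    {P : ℝ → InfVolFermionState 2 → Prop} {tb : ℚ}
    (hT : ∀ s ∈ Set.Icc sA sB, ∀ (ω : InfVolFermionState 2) (Ls : ℕ → ℕ) (ψ : ∀ L, Fock (Orb (FermionTorus 2 L))),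
      Tendsto Ls atTop atTop →
      (∀ j, IsGroundStateInSector (hubbardTorusTT' (Ls j) 1 s U) (rectN n (Ls j)) 0 (ψ (Ls j))) →
      (∀ j, star (ψ (Ls j)) ⬝ᵥ ψ (Ls j) = 1) → ω.IsTorusLimitOf ψ Ls → P s ω →
      |ω.meanEnergy (hubbardTTPrimeFermionInteraction 0 1 0) 1| ≤ ((tb : ℚ) : ℝ))
    (hX : ∀ ω : InfVolFermionState 2, ω.IsTranslationInvariant → ∀ s ∈ Set.Icc sA sB,
      (sB - s) * tPrimeObjOrbitMean X sA ω + (s - sA) * tPrimeObjOrbitMean X sB ω ≤ (sB - sA) * tPrimeObjOrbitMean X s ω)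
    {F : ℚ}
    (hF : ∀ w : ℝ, 0 ≤ w → w ≤ 1 →
      ((F : ℚ) : ℝ) ≤ (1 - w) * ((βA : ℚ) : ℝ) + w * ((βB : ℚ) : ℝ) -
        w * (1 - w) * ((sB - sA) * |((((κB - κA) - (κB' - κA') : ℚ)) : ℝ)| * ((tb : ℚ) : ℝ) -
          ((((κB' - κA') * (-(flB - flA)) : ℚ)) : ℝ))) :
    TPrimeBundleOrbitLowerRowExt P U n sA sB flA flB u F X := by
  obtain ⟨E₀, E₁, hh⟩ := h
  intro s hs hfl ω Ls ψ hLs hψ hψ1 hω hu hP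
  obtain ⟨hE, hVA, hVB⟩ := hh s hs ω Ls ψ hLs hψ hψ1 hω
  -- abbreviations
  set e : ℝ := energyDensityTT' 1 s U n with he
  set T : ℝ := ω.meanEnergy (hubbardTTPrimeFermionInteraction 0 1 0) 1 with hTdef
  have hΔ : 0 < sB - sA := sub_pos.2 hAB
  -- the barycentric weight
  set w : ℝ := (s - sA) / (sB - sA) with hw
  have hw0 : 0 ≤ w := div_nonneg (sub_nonneg.2 hs.1) hΔ.le
  have hw1 : w ≤ 1 := by rw [hw, div_le_one hΔ]; linarith [hs.2]
  have hsw : s = sA + w * (sB - sA) := by rw [hw]; field_simp; ring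
  have e1 : sB - s = (1 - w) * (sB - sA) := by rw [hsw]; ring
  have e2 : s - sA = w * (sB - sA) := by rw [hsw]; ring
  -- the chord floor at the barycentre and the floor premise
  have hflw : (1 - w) * ((flA : ℚ) : ℝ) + w * ((flB : ℚ) : ℝ) ≤ e := by
    rw [← bundleChordFloor_baryc hAB flA flB w, ← hsw]; exact hfl
  -- the K₂ box
  have hTb : |T| ≤ ((tb : ℚ) : ℝ) := hT s hs ω Ls ψ hLs hψ hψ1 hω hP
  -- the objective chord on the (translation-invariant) torus limit
  have hXw : (1 - w) * tPrimeObjOrbitMean X sA ω + w * tPrimeObjOrbitMean X sB ω ≤ tPrimeObjOrbitMean X s ω := by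
    have h' := hX ω hω.isTranslationInvariant s hs
    rw [e1, e2] at h'
    exact le_of_mul_le_mul_left (h'.trans' (le_of_eq (by ring))) hΔ
  -- signs
  have hκA0 : (0 : ℝ) ≤ ((κA : ℚ) : ℝ) := by exact_mod_cast hκA
  have hκA0' : (0 : ℝ) ≤ ((κA' : ℚ) : ℝ) := by exact_mod_cast hκA'
  have hκB0 : (0 : ℝ) ≤ ((κB : ℚ) : ℝ) := by exact_mod_cast hκB
  have hκB0' : (0 : ℝ) ≤ ((κB' : ℚ) : ℝ) := by exact_mod_cast hκB'
  have huA' : ((u : ℚ) : ℝ) ≤ ((cA : ℚ) : ℝ) := by exact_mod_cast huA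
  have huB' : ((u : ℚ) : ℝ) ≤ ((cB : ℚ) : ℝ) := by exact_mod_cast huB
  -- (1) convex combination of the two vertex rows
  have h1 : (1 - w) * (((βA : ℚ) : ℝ) + ((κA : ℚ) : ℝ) * (((cA : ℚ) : ℝ) - e + (s - sA) * T) +
      ((κA' : ℚ) : ℝ) * (e - (s - sA) * T - ((flA : ℚ) : ℝ)) + E₀ ω + sA * E₁ ω) +
      w * (((βB : ℚ) : ℝ) + ((κB : ℚ) : ℝ) * (((cB : ℚ) : ℝ) - e + (s - sB) * T) +
      ((κB' : ℚ) : ℝ) * (e - (s - sB) * T - ((flB : ℚ) : ℝ)) + E₀ ω + sB * E₁ ω) ≤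
      (1 - w) * tPrimeObjOrbitMean X sA ω + w * tPrimeObjOrbitMean X sB ω := by
    have a := mul_le_mul_of_nonneg_left hVA (sub_nonneg.2 hw1)
    have b := mul_le_mul_of_nonneg_left hVB hw0
    linarith [a, b]
  -- (2) each cap slack is nonnegative (`e ≤ u ≤ c`), the combined cut multiplier times the chord-floor slack is nonnegative
  have h2 : 0 ≤ (1 - w) * ((κA : ℚ) : ℝ) * (((cA : ℚ) : ℝ) - e) + w * ((κB : ℚ) : ℝ) * (((cB : ℚ) : ℝ) - e) :=
    add_nonneg (mul_nonneg (mul_nonneg (sub_nonneg.2 hw1) hκA0) (by linarith [hu]))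
      (mul_nonneg (mul_nonneg hw0 hκB0) (by linarith [hu]))
  have h3 : 0 ≤ ((1 - w) * ((κA' : ℚ) : ℝ) + w * ((κB' : ℚ) : ℝ)) *
      (e - ((1 - w) * ((flA : ℚ) : ℝ) + w * ((flB : ℚ) : ℝ))) :=
    mul_nonneg (add_nonneg (mul_nonneg (sub_nonneg.2 hw1) hκA0') (mul_nonneg hw0 hκB0')) (by linarith [hflw])
  -- (3) the hopping coefficient priced on the K₂ box
  have h4 : ((((κB - κA) - (κB' - κA') : ℚ)) : ℝ) * T ≤ |((((κB - κA) - (κB' - κA') : ℚ)) : ℝ)| * ((tb : ℚ) : ℝ) := by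
    calc ((((κB - κA) - (κB' - κA') : ℚ)) : ℝ) * T ≤ |((((κB - κA) - (κB' - κA') : ℚ)) : ℝ) * T| := le_abs_self _
      _ = |((((κB - κA) - (κB' - κA') : ℚ)) : ℝ)| * |T| := abs_mul _ _
      _ ≤ |((((κB - κA) - (κB' - κA') : ℚ)) : ℝ)| * ((tb : ℚ) : ℝ) := mul_le_mul_of_nonneg_left hTb (abs_nonneg _)
  have h4' : 0 ≤ w * (1 - w) * (sB - sA) := mul_nonneg (mul_nonneg hw0 (sub_nonneg.2 hw1)) hΔ.le
  have h5 := mul_le_mul_of_nonneg_left h4 h4'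
  -- (4) the slot is below the parabola at this w
  have h6 := hF w hw0 hw1
  -- (5) the algebraic identity behind the law (s = sA + w Δs), then (E) kills the eom part
  have key : (1 - w) * (((βA : ℚ) : ℝ) + ((κA : ℚ) : ℝ) * (((cA : ℚ) : ℝ) - e + (s - sA) * T) +
      ((κA' : ℚ) : ℝ) * (e - (s - sA) * T - ((flA : ℚ) : ℝ)) + E₀ ω + sA * E₁ ω) +
      w * (((βB : ℚ) : ℝ) + ((κB : ℚ) : ℝ) * (((cB : ℚ) : ℝ) - e + (s - sB) * T) +
      ((κB' : ℚ) : ℝ) * (e - (s - sB) * T - ((flB : ℚ) : ℝ)) + E₀ ω + sB * E₁ ω) =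
      (1 - w) * ((βA : ℚ) : ℝ) + w * ((βB : ℚ) : ℝ) +
      (E₀ ω + s * E₁ ω) +
      ((1 - w) * ((κA : ℚ) : ℝ) * (((cA : ℚ) : ℝ) - e) + w * ((κB : ℚ) : ℝ) * (((cB : ℚ) : ℝ) - e)) +
      ((1 - w) * ((κA' : ℚ) : ℝ) + w * ((κB' : ℚ) : ℝ)) * (e - ((1 - w) * ((flA : ℚ) : ℝ) + w * ((flB : ℚ) : ℝ))) +
      w * (1 - w) * ((((κB' - κA') * (-(flB - flA)) : ℚ)) : ℝ) -
      w * (1 - w) * (sB - sA) * (((((κB - κA) - (κB' - κA') : ℚ)) : ℝ) * T) := by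
    rw [hsw]; push_cast; ring
  rw [hE] at key
  have hgoal : ((F : ℚ) : ℝ) ≤ tPrimeObjOrbitMean X s ω := by linarith [h1, h2, h3, h5, h6, key, hXw]
  simpa [tPrimeObjOrbitMean] using hgoal

/-- **PINNED t′-PAIR ⇒ PLAIN t′-BUNDLE ROW WITH THE KERNEL K₂-BOX `tb = 16211390/10⁷`** (`|e_{Φ(0,1,0)}(ω)| ≤ 16/π² < 1.6211390` for every torus limit of unit
FIXED-DENSITY vectors, `0 ≤ n < 2` — Lieb–Loss bathtub, `IsTorusLimitOf.abs_meanEnergy_diagHop_le_decimal`, exactly the row's binders; pointer hubbard-cov-la214-box-1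
g2, hubbard-obs STATUS 2026-08-28T19:27:11Z): as `bundleExt` with NO extra premise and `L = (16211390/10⁷)·(sB − sA)·|Δκ_cap − Δκ_cut| − Δκ_cut·(−(flB − flA))`. The
readers' box constants are all LOOSER (`8h♯ = 2027/1250 = 1.6216`, `8h = 2.528` at `h = 79/250`, unit `8`), so every reader-priced t′-pair node follows A FORTIORI
(`tPrimePair_slot_mono`). [cite: LiebLoss1993, §8, Theorem 8.2] [cite: BoydVandenberghe2004, §5.9] -/
theorem SquareTTPrimePinnedPairRowT.bundle
    (h : SquareTTPrimePinnedPairRowT U n sA sB cA cB flA flB βA κA κA' βB κB κB' X) (hn0 : 0 ≤ n) (hn2 : n < 2)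
    (hAB : sA < sB) (hκA : 0 ≤ κA) (hκA' : 0 ≤ κA') (hκB : 0 ≤ κB) (hκB' : 0 ≤ κB')
    {u : ℚ} (huA : u ≤ cA) (huB : u ≤ cB)
    (hX : ∀ ω : InfVolFermionState 2, ω.IsTranslationInvariant → ∀ s ∈ Set.Icc sA sB,
      (sB - s) * tPrimeObjOrbitMean X sA ω + (s - sA) * tPrimeObjOrbitMean X sB ω ≤ (sB - sA) * tPrimeObjOrbitMean X s ω)
    {F : ℚ}
    (hF : ∀ w : ℝ, 0 ≤ w → w ≤ 1 →
      ((F : ℚ) : ℝ) ≤ (1 - w) * ((βA : ℚ) : ℝ) + w * ((βB : ℚ) : ℝ) -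
        w * (1 - w) * ((sB - sA) * |((((κB - κA) - (κB' - κA') : ℚ)) : ℝ)| * (((16211390 / 10000000 : ℚ)) : ℝ) -
          ((((κB' - κA') * (-(flB - flA)) : ℚ)) : ℝ))) :
    TPrimeBundleOrbitLowerRow U n sA sB flA flB u F X := by
  have hExt : TPrimeBundleOrbitLowerRowExt (fun _ _ => True) U n sA sB flA flB u F X :=
    h.bundleExt hAB hκA hκA' hκB hκB' huA huB (P := fun _ _ => True) (tb := 16211390 / 10000000)
      (fun s _ ω Ls ψ hLs hψ hψ1 hω _ => by
        have hN : ∀ j, IsNParticle (rectN n (Ls j)) (ψ (Ls j)) := fun j => ((mem_szSector_iff _ _ _).1 (hψ j).1).1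
        have hb := hω.abs_meanEnergy_diagHop_le_decimal hn0 hn2 hLs hN hψ1
        exact hb.trans (le_of_eq (by push_cast; norm_num)))
      hX hF
  exact fun s hs hfl => (hExt s hs hfl).row_of_forall fun _ _ _ _ _ _ _ => trivial

end Law

/-! ## §D  The reader's floor kinds -/

section Kinds

/-- **A FORTIORI IN THE BOX CONSTANT**: a slot below the parabola of a LARGER sharing constant `L′ ≥ L` is below the parabola of `L` on `w ∈ [0, 1]`
(`−w(1 − w) ≤ 0`) — every node priced by a reader at a looser K₂-box (unit `8`, `8h`, `8h♯`) discharges against the kernel constant. [folklore] -/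
theorem tPrimePair_slot_mono {F βA βB L L' : ℝ} (hLL : L ≤ L')
    (hF : ∀ w : ℝ, 0 ≤ w → w ≤ 1 → F ≤ (1 - w) * βA + w * βB - w * (1 - w) * L') :
    ∀ w : ℝ, 0 ≤ w → w ≤ 1 → F ≤ (1 - w) * βA + w * βB - w * (1 - w) * L := fun w hw0 hw1 => by
  have h3 : 0 ≤ w * (1 - w) := mul_nonneg hw0 (by linarith)
  nlinarith [hF w hw0 hw1, mul_le_mul_of_nonneg_left hLL h3]

/-- Vertex-bound case: for `0 ≤ L ≤ |βB − βA|` (the gap dominates the sharing constant) and `w ∈ [0, 1]`, `min βA βB ≤ (1 − w)βA + wβB − w(1 − w)L` — the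
parabola's minimum over `[0, 1]` sits at an end. [folklore] -/
theorem tPrimePair_vertexFloor_le (βA βB L w : ℝ) (hL0 : 0 ≤ L) (hL : L ≤ |βB - βA|) (hw0 : 0 ≤ w) (hw1 : w ≤ 1) :
    min βA βB ≤ (1 - w) * βA + w * βB - w * (1 - w) * L := by
  have h3 : 0 ≤ w * (1 - w) := mul_nonneg hw0 (by linarith)
  rcases le_total βA βB with hab | hab
  · rw [min_eq_left hab]
    rw [abs_of_nonneg (sub_nonneg.2 hab)] at hL
    -- (1-w)βA + wβB − w(1−w)L − βA = w[(βB − βA) − (1 − w)L] ≥ w[(βB−βA) − L] ≥ 0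
    nlinarith [mul_nonneg hw0 (sub_nonneg.2 hL), mul_nonneg (mul_nonneg hw0 hw0) hL0]
  · rw [min_eq_right hab]
    rw [abs_of_nonpos (sub_nonpos.2 hab)] at hL
    nlinarith [mul_nonneg (sub_nonneg.2 hw1) (by linarith : (0:ℝ) ≤ (βA - βB) - L),
      mul_nonneg (mul_nonneg (sub_nonneg.2 hw1) (sub_nonneg.2 hw1)) hL0]

variable {U n sA sB : ℝ} {cA cB flA flB βA κA κA' βB κB κB' : ℚ} {X : ℝ → FermionOp (Literature.Probability.LatticeModels.box 2 7)}

/-- **INTERIOR KIND (plain row, kernel box `16211390/10⁷`).** As `bundle`, with the slot hypothesis replaced by the reader's interior floor: `0 < L` and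
`F ≤ βA − (L − (βB − βA))²/(4L)`. [cite: BoydVandenberghe2004, §5.9] -/
theorem SquareTTPrimePinnedPairRowT.bundle_interior
    (h : SquareTTPrimePinnedPairRowT U n sA sB cA cB flA flB βA κA κA' βB κB κB' X) (hn0 : 0 ≤ n) (hn2 : n < 2)
    (hAB : sA < sB) (hκA : 0 ≤ κA) (hκA' : 0 ≤ κA') (hκB : 0 ≤ κB) (hκB' : 0 ≤ κB')
    {u : ℚ} (huA : u ≤ cA) (huB : u ≤ cB)
    (hX : ∀ ω : InfVolFermionState 2, ω.IsTranslationInvariant → ∀ s ∈ Set.Icc sA sB,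
      (sB - s) * tPrimeObjOrbitMean X sA ω + (s - sA) * tPrimeObjOrbitMean X sB ω ≤ (sB - sA) * tPrimeObjOrbitMean X s ω)
    {F : ℚ} {L : ℝ}
    (hLdef : L = (sB - sA) * |((((κB - κA) - (κB' - κA') : ℚ)) : ℝ)| * (((16211390 / 10000000 : ℚ)) : ℝ) - ((((κB' - κA') * (-(flB - flA)) : ℚ)) : ℝ))
    (hL : 0 < L) (hF : ((F : ℚ) : ℝ) ≤ ((βA : ℚ) : ℝ) - (L - (((βB : ℚ) : ℝ) - ((βA : ℚ) : ℝ))) ^ 2 / (4 * L)) :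
    TPrimeBundleOrbitLowerRow U n sA sB flA flB u F X :=
  h.bundle hn0 hn2 hAB hκA hκA' hκB hκB' huA huB hX fun w _ _ => by
    rw [← hLdef]; exact hF.trans (pinnedPair_segFloor_le _ _ L w hL)

/-- **VERTEX KIND (plain row, kernel box `16211390/10⁷`): `L ≤ |βB − βA|`** (either `L ≤ 0`, or the vertex gap dominates the sharing constant — the K1 pairs {hub′, S1′} /
{hub′, Q′}) and `F ≤ min βA βB`. [cite: BoydVandenberghe2004, §5.9] -/
theorem SquareTTPrimePinnedPairRowT.bundle_vertex
    (h : SquareTTPrimePinnedPairRowT U n sA sB cA cB flA flB βA κA κA' βB κB κB' X) (hn0 : 0 ≤ n) (hn2 : n < 2)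
    (hAB : sA < sB) (hκA : 0 ≤ κA) (hκA' : 0 ≤ κA') (hκB : 0 ≤ κB) (hκB' : 0 ≤ κB')
    {u : ℚ} (huA : u ≤ cA) (huB : u ≤ cB)
    (hX : ∀ ω : InfVolFermionState 2, ω.IsTranslationInvariant → ∀ s ∈ Set.Icc sA sB,
      (sB - s) * tPrimeObjOrbitMean X sA ω + (s - sA) * tPrimeObjOrbitMean X sB ω ≤ (sB - sA) * tPrimeObjOrbitMean X s ω)
    {F : ℚ} {L : ℝ}
    (hLdef : L = (sB - sA) * |((((κB - κA) - (κB' - κA') : ℚ)) : ℝ)| * (((16211390 / 10000000 : ℚ)) : ℝ) - ((((κB' - κA') * (-(flB - flA)) : ℚ)) : ℝ))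
    (hL : L ≤ |((βB : ℚ) : ℝ) - ((βA : ℚ) : ℝ)|) (hF : F ≤ min βA βB) :
    TPrimeBundleOrbitLowerRow U n sA sB flA flB u F X :=
  h.bundle hn0 hn2 hAB hκA hκA' hκB hκB' huA huB hX fun w hw0 hw1 => by
    rw [← hLdef]
    have hF' : ((F : ℚ) : ℝ) ≤ min ((βA : ℚ) : ℝ) ((βB : ℚ) : ℝ) :=
      le_min (by exact_mod_cast hF.trans (min_le_left _ _)) (by exact_mod_cast hF.trans (min_le_right _ _))
    rcases le_or_gt L 0 with hL0 | hL0
    · exact hF'.trans (pinnedPair_endpointFloor_le _ _ L w hL0 hw0 hw1)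
    · exact hF'.trans (tPrimePair_vertexFloor_le _ _ L w hL0.le hL hw0 hw1)

end Kinds

/-! ## §E  The objective chord condition for the two objective families of record -/

section Objectives

/-- **Constant (corner) objective**: the chord condition is an identity. [folklore] -/
theorem tPrimeObj_chord_const (X₀ : FermionOp (Literature.Probability.LatticeModels.box 2 7)) (sA sB : ℝ) :
    ∀ ω : InfVolFermionState 2, ω.IsTranslationInvariant → ∀ s ∈ Set.Icc sA sB,
      (sB - s) * tPrimeObjOrbitMean (fun _ => X₀) sA ω + (s - sA) * tPrimeObjOrbitMean (fun _ => X₀) sB ω ≤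
        (sB - sA) * tPrimeObjOrbitMean (fun _ => X₀) s ω := by
  intro ω _ s _
  unfold tPrimeObjOrbitMean
  exact le_of_eq (by ring)

/-- **The own f-sum word `s ↦ −X₀(s, Uo)`**: on translation-invariant states its orbit mean is `¼ e_{Φ(1,2s,0)}(ω)`, AFFINE in `s`, so the chord condition is
an identity. [cite: BratteliKishimotoRobinson1978, §3 (mean energy functional)] -/
theorem tPrimeObj_chord_negOddMomentTT (Uo sA sB : ℝ) :
    ∀ ω : InfVolFermionState 2, ω.IsTranslationInvariant → ∀ s ∈ Set.Icc sA sB,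
      (sB - s) * tPrimeObjOrbitMean (fun c => -oddMomentObsTT c Uo 0) sA ω + (s - sA) * tPrimeObjOrbitMean (fun c => -oddMomentObsTT c Uo 0) sB ω ≤
        (sB - sA) * tPrimeObjOrbitMean (fun c => -oddMomentObsTT c Uo 0) s ω := by
  intro ω hω s _
  have hm : ∀ c : ℝ, tPrimeObjOrbitMean (fun c => -oddMomentObsTT c Uo 0) c ω =
      (1 / 4) * ω.meanEnergy (hubbardTTPrimeFermionInteraction 1 (2 * c) 0) 1 := fun c => by
    unfold tPrimeObjOrbitMean
    exact orbitMean_re_expect_neg_oddMomentTT_lam_zero hω c Uo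
  have ha : ∀ c : ℝ, ω.meanEnergy (hubbardTTPrimeFermionInteraction 1 (2 * c) 0) 1 =
      ω.meanEnergy (hubbardTTPrimeFermionInteraction 1 0 0) 1 + (0 - 0) * ω.meanEnergy (hubbardTTPrimeFermionInteraction 0 0 1) 1 +
        (2 * c - 0) * ω.meanEnergy (hubbardTTPrimeFermionInteraction 0 1 0) 1 := fun c =>
    ω.meanEnergy_hubbardTTPrime_affine 1 0 0 (2 * c) 0
  rw [hm, hm, hm, ha sA, ha sB, ha s]
  exact le_of_eq (by ring)

end Objectives

end Summit.Ventures.CertifiedManyBodySolver.Downfold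

end
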